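import Summits.BirchSwinnertonDyer.BirchSwinnertonDyer.Theorems.ErratumRoadFiveNonSurjCornerKolyJSwapKappa
import Summits.BirchSwinnertonDyer.Rank1Residual.X10.LeafDischargeX10bKolyvaginOdd
import HarnessLib

/-!
# Route `ErratumRoadFive` (rung K2), crux child `NonSurjCornerKolyJ` (item stmt-BirchSwinnertonDyer-19947) ∕ K2@3 crux
# `CornerAtThreeW` (item 21420): the level-`3^{M+1}` Prop-4.4 supplier AT `p = 3` WITHOUT the `ℓ = 2` residue `h2`, on frames
# with `d_K ≡ 1 (mod 8)` (cell `bsd-stepL`, seat `bsd-stepL-mult-p3` g5; `--supports stmt-BirchSwinnertonDyer-19947 --as helper`;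
# planner g37 RULING 38 «T-19111-ℓ2 sharpened: Heegner-field SUPPLY with d_K ≡ 1 (mod 8)»)

WHY. corner-p1 g11's `Koly.h44_family_three_of_frobeniusCongruence` (p553223) supplies McCallum Prop. 4.4 at level `3^{M+1}` along
every Zhang–Kolyvagin prime step `ℓ` from the Literature fact `GrossLMS1991.prop37_2_frobeniusCongruence` (Gross 1991 Prop. 3.7 (2) =
Nekovář 2007 Prop. 4.13 (ii), image-free, printed for `ℓ ≠ 2`) EXCEPT at `ℓ = 2`, carried as the displayed hypothesis `h2` (referee
target «T-19111-ℓ2», RELAY BATCH 37; display v3 @3 p554829 conjunct (iv′)). RULING 38: on a Heegner frame with `d_K ≡ 1 (mod 8)` the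
prime `2` SPLITS in `K`, so it is never a Zhang–Kolyvagin prime (Zhang 2014 (xii) «inert»; tree theorem
`ne_two_of_zhangKolyvaginPrime_of_discr_mod_eight_eq_one`, print-x9 p559314) and `h2` is VACUOUS. This file records the resulting
supplier with the frame clause `NumberField.discr K % 8 = 1` IN PLACE OF `h2`, everything else verbatim; such frames with
`L(E^{d_K},1) ≠ 0` exist for every `E` with `w(E) = −1` by Friedberg–Hoffstein 1995 Thm. B in its finite-set form — ALREADY a typed
fact of the tree (`friedbergHoffstein_exists_heegnerField_splitDivisors_twist_ne_zero`, consumed by bsd-cited r19's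
`Rank1Residual.exists_admissibleField_discr_emod_eight_of_friedbergHoffstein`: `K` with `d_K ≡ 1 (mod 8)`, `d_K < −4`, Heegner for
`N_E`, `2` and `p`) — and, numerically, with an EXACT twin on every corner pair of the D-h census (`HOME/mult-p3/census-g5/
DH-oddN-split2-witnesses.tsv`). HONEST FRAMING: one theorem, no definition ∕ fact ∕ sorry; CONDITIONAL on the named fact
`GrossLMS1991.prop37_2_frobeniusCongruence`; no stub closes; nothing about any curve; BSD is not advanced; T7.
References: [cite: McCallumLMS1991, §4 Prop. 4.4 (p. 301)] [cite: GrossLMS1991, Prop. 3.7 (2) (p. 240)]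
[cite: Nekovar2007, Prop. 4.13 (ii), (4.3)] [cite: WZhang2014, Notations (xii)] [cite: FriedbergHoffstein1995, Thm. B]
[cite: JetchevSkinnerWan2017, §7.4.1–7.4.2].
-/

set_option autoImplicit false

noncomputable section

open scoped Classical NumberField

namespace Summit.BirchSwinnertonDyer.Rank1Residual.X11b.Three.Koly

open WeierstrassCurve IsDedekindDomain NumberField Field Literature.NumberTheory.EllipticCurves
  Literature.NumberTheory.EllipticCurves.ModularForms Literature.NumberTheory.EllipticCurves.Jetchev2008
  Literature.NumberTheory.EllipticCurves.Rank1Residual Literature.NumberTheory.EllipticCurves.KolyvaginCocycle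
  Literature.NumberTheory.GaloisRepresentations Literature.NumberTheory.GaloisCohomology
  Literature.NumberTheory.GaloisRepresentations.DiscreteGaloisModule
  Summit.BirchSwinnertonDyer.Rank1Residual Summit.BirchSwinnertonDyer.Rank1Residual.X11b
  Summit.BirchSwinnertonDyer.Rank1Residual.JET
  Summit.BirchSwinnertonDyer.BirchSwinnertonDyer.Theorems

variable {K : Type} [Field K] [NumberField K] (W : WeierstrassCurve ℚ) [W.IsElliptic] [W.IsGloballyMinimal]
  [NeZero (W.conductorNorm ℤ)]

/-- **The level-`3^{M+1}` Prop-4.4 supplier at `p = 3` on a frame with `d_K ≡ 1 (mod 8)` — NO `ℓ = 2` residue.**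
`Koly.h44_family_three_of_frobeniusCongruence` with its displayed hypothesis `h2` replaced by the frame clause
`NumberField.discr K % 8 = 1`: then `2` splits in `K`, no Zhang–Kolyvagin prime equals `2`
(`ne_two_of_zhangKolyvaginPrime_of_discr_mod_eight_eq_one`), and EVERY prime step comes from the named fact
`GrossLMS1991.prop37_2_frobeniusCongruence` through the ANY-PAIR Prop. 4.4 on the irreducible cell
(`Prop44.kolyvaginClass_mul_mem_torsionLocalKer_iff_of_irr`). Conclusion byte-identical to the `h2` version's.
CONDITIONAL on the fact; nothing booked. [cite: McCallumLMS1991, §4 Prop. 4.4 (p. 301)]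
[cite: GrossLMS1991, Prop. 3.7 (2) (p. 240)] [cite: Nekovar2007, Prop. 4.13 (ii), (4.3)] [cite: WZhang2014, Notations (xii)] -/
theorem h44_family_three_of_frobeniusCongruence_of_discr_emod_eight (h37 : GrossLMS1991.prop37_2_frobeniusCongruence)
    (hK : IsImaginaryQuadratic K) (hD : NumberField.discr K < -4) (h8 : NumberField.discr K % 8 = 1)
    (hH : SatisfiesHeegnerHypothesis (W.conductorNorm ℤ) K)
    (hHp : SatisfiesHeegnerHypothesis 3 K) (hirr : W.HasIrreducibleModPGaloisRep 3)
    (Dt : ModularParametrizationData W (W.conductorNorm ℤ)) (β : ℤ) (ι : K →+* ℂ) (M : ℕ)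
    (D : ∀ s : {m : ℕ // Squarefree m ∧ ∀ q ∈ m.primeFactors,
        Zhang2014.IsKolyvaginPrime (W.conductorNorm ℤ) W K 3 q ∧ M + 1 ≤ Zhang2014.kolyvaginIndex W 3 q},
      KolyvaginHeegnerData Dt β ι s.1) :
    ∀ (s s' : {m : ℕ // Squarefree m ∧ ∀ q ∈ m.primeFactors,
        Zhang2014.IsKolyvaginPrime (W.conductorNorm ℤ) W K 3 q ∧ M + 1 ≤ Zhang2014.kolyvaginIndex W 3 q}) (ℓ : ℕ),
      Zhang2014.IsKolyvaginPrime (W.conductorNorm ℤ) W K 3 ℓ → M + 1 ≤ Zhang2014.kolyvaginIndex W 3 ℓ →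
      ¬ ℓ ∣ s.1 → s'.1 = s.1 * ℓ → ∀ v : HeightOneSpectrum (𝓞 K), (ℓ : 𝓞 K) ∈ v.asIdeal →
      ((D s').kolyvaginClass Nat.prime_three (M + 1) ∈
          (W.baseChange K).torsionLocalKer (v.adicCompletion K) ((3 ^ (M + 1) : ℕ) : ℤ) ↔
        (D s).kolyvaginClass Nat.prime_three (M + 1) ∈
          (W.baseChange K).torsionLocalKer (v.adicCompletion K) ((3 ^ (M + 1) : ℕ) : ℤ)) := by
  refine h44_family_three_of_frobeniusCongruence W h37 hK hD hH hHp hirr Dt β ι M D ?_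
  intro s s' hKol _ _ _ _ _
  exact absurd rfl (ne_two_of_zhangKolyvaginPrime_of_discr_mod_eight_eq_one (W.conductorNorm ℤ) W 3 hK.1 h8 hKol)

end Summit.BirchSwinnertonDyer.Rank1Residual.X11b.Three.Koly

end
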